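import Summits.QuantumAdvantage.QuantumAdvantage.Theorems.LinnikCubicClassGroupsDegreeOnePrimesEscapeDeuringCoefficients
import Mathlib.NumberTheory.NumberField.Discriminant.Different
import HarnessLib

/-!
# The ramified junk in the Deuring reduction: `ψ_{ram}(y) ≤ [E:ℚ] ω(d_N) log y`

Topic `Summits/QuantumAdvantage/QuantumAdvantage/Theorems`, cell B2b-1 (linnik-cubic), PART A (gen 12);
helper toward the crux `DegreeOnePrimesEscape` (stmt-QuantumAdvantage-11543) — the Lagarias–Montgomery–Odlyzko
programme for conjugacy classes inside a division (LMO-PLAN, step M4).  HONEST FRAMING: the value of this file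
is a LEMMA (kernel-checked) — NOT summit progress.

For an extension of number fields `N|E`, the weighted Chebyshev function of the prime powers `𝔭^k` (`k ≥ 1`)
of `E` with `𝔭` ramified in `N` (the junk weight `w_ram` of `…DeuringCoefficients.lean`) is small:

* `dvd_discr_of_not_isUnramifiedIn` — if `𝔭 ∋ p` is ramified in `N|E` then `p ∣ d_N` (a prime of `N` above
  `𝔭` is ramified over `ℤ`; Mathlib `NumberField.not_dvd_discr_iff_forall_mem`, `IsUnramifiedAt.of_restrictScalars`);
* `sum_primePow_vonMangoldt_le_log` — `Σ_{k ≥ 1, N𝔭^k ≤ y} Λ(𝔭^k) ≤ log y`;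
* `psiWeighted_ram_le` — `ψ_{w_ram}(y) ≤ [E:ℚ] · ω(|d_N|) · log y` for `y ≥ 1` (at most `[E:ℚ]` primes of `E`
  above each of the `ω(|d_N|)` rational primes dividing `d_N`; `ω(d) ≤ log d/log 2` is
  `Literature.NumberTheory.Sieve.Chen.card_primeFactors_le_log_div`).

References: [LagariasMontgomeryOdlyzko1979, §3 (the ramified primes contribute `O(log d_L)` per unit of `log x`)].
-/

noncomputable section

open Finset Real Complex NumberField IsDedekindDomain UniqueFactorizationMonoid
open scoped NumberField nonZeroDivisors Classical

namespace Summit.QuantumAdvantage.QuantumAdvantage.Theorems.DegreeOnePrimesEscape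

open Literature.NumberTheory.LFunctions Literature.NumberTheory.LFunctions.NumberField
  Literature.NumberTheory.GaloisRepresentations

variable {E N : Type} [Field E] [NumberField E] [Field N] [NumberField N] [Algebra E N]

/-! ### Ramified in `N|E` ⇒ above a prime dividing `d_N` -/

omit [NumberField E] in
/-- If a prime `𝔭 ∋ p` of `E` is ramified in `N`, then `p ∣ d_N`. -/
theorem dvd_discr_of_not_isUnramifiedIn (v : IsDedekindDomain.HeightOneSpectrum (𝓞 E)) {p : ℕ} (hp : p.Prime)
    (hpv : (p : 𝓞 E) ∈ v.asIdeal) (hram : ¬ Algebra.IsUnramifiedIn (𝓞 N) v.asIdeal) :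
    (p : ℤ) ∣ NumberField.discr N := by
  by_contra hnd
  have hpZ : Prime (p : ℤ) := Nat.prime_iff_prime_int.mp hp
  apply hram
  intro P hP hlies
  have hmem : ((p : ℤ) : 𝓞 N) ∈ P := by
    rw [Int.cast_natCast]
    have : algebraMap (𝓞 E) (𝓞 N) (p : 𝓞 E) ∈ P := by
      rw [← Ideal.mem_comap]
      have h := hlies.over
      rw [Ideal.under_def] at h
      rw [← h]; exact hpv
    rwa [map_natCast] at this
  have hZ : Algebra.IsUnramifiedAt ℤ P := (NumberField.not_dvd_discr_iff_forall_mem N (𝓞 N) hpZ).mp hnd P hP hmem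
  exact Algebra.IsUnramifiedAt.of_restrictScalars ℤ P

/-- A nonzero prime `𝔭` of `E` contains a rational prime `p`, and lies in `primesOverFinset (p)`. -/
theorem exists_prime_mem (v : IsDedekindDomain.HeightOneSpectrum (𝓞 E)) :
    ∃ p : ℕ, p.Prime ∧ (p : 𝓞 E) ∈ v.asIdeal ∧
      v.asIdeal ∈ IsDedekindDomain.primesOverFinset (Ideal.span {(p : ℤ)}) (𝓞 E) := by
  classical
  haveI : v.asIdeal.IsMaximal := v.isPrime.isMaximal v.ne_bot
  set 𝔮 : Ideal ℤ := v.asIdeal.under ℤ with h𝔮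
  haveI : 𝔮.IsPrime := Ideal.IsPrime.under ℤ v.asIdeal
  have h𝔮0 : 𝔮 ≠ ⊥ := by
    intro h0
    have hmem : ((Ideal.absNorm v.asIdeal : ℕ) : ℤ) ∈ 𝔮 := by
      rw [h𝔮, Ideal.under_def, Ideal.mem_comap, map_natCast]; exact Ideal.absNorm_mem _
    rw [h0, Ideal.mem_bot] at hmem
    have : Ideal.absNorm v.asIdeal ≠ 0 := by rw [ne_eq, Ideal.absNorm_eq_zero_iff]; exact v.ne_bot
    exact this (by exact_mod_cast hmem)
  set q : ℤ := Submodule.IsPrincipal.generator 𝔮 with hq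
  have hqprime : Prime q := Submodule.IsPrincipal.prime_generator_of_isPrime 𝔮 h𝔮0
  have hqmem : q ∈ 𝔮 := Submodule.IsPrincipal.generator_mem 𝔮
  set p : ℕ := q.natAbs with hpdef
  have hp : p.Prime := Int.prime_iff_natAbs_prime.mp hqprime
  have hspan : Ideal.span {(p : ℤ)} = 𝔮 := by
    rw [hpdef, Int.span_natAbs, hq, Ideal.span_singleton_generator]
  have hqE : (q : 𝓞 E) ∈ v.asIdeal := by
    have := hqmem; rw [h𝔮, Ideal.under_def, Ideal.mem_comap] at this; simpa using this
  have hpE : (p : 𝓞 E) ∈ v.asIdeal := by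
    rcases Int.natAbs_eq q with h | h
    · have : ((p : ℤ) : 𝓞 E) ∈ v.asIdeal := by rw [hpdef, ← h]; exact hqE
      simpa using this
    · have : ((p : ℤ) : 𝓞 E) ∈ v.asIdeal := by
        rw [hpdef, show ((q.natAbs : ℕ) : ℤ) = -q by omega, Int.cast_neg]; exact v.asIdeal.neg_mem hqE
      simpa using this
  refine ⟨p, hp, hpE, ?_⟩
  have hp0 : Ideal.span {(p : ℤ)} ≠ ⊥ := by simp [hp.ne_zero]
  haveI := Fact.mk hp
  rw [IsDedekindDomain.mem_primesOverFinset_iff hp0]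
  exact ⟨v.isPrime, ⟨by rw [hspan]⟩⟩

/-! ### Prime powers of one prime below `y` -/

/-- `Σ_{I ∈ S, I = 𝔭^k (k ≥ 1)} Λ(I) ≤ log y` for any finite set `S` of ideals of norm `≤ y`. -/
theorem sum_primePow_vonMangoldt_le_log (v : IsDedekindDomain.HeightOneSpectrum (𝓞 E)) {y : ℝ} (hy : 1 ≤ y)
    (S : Finset (Ideal (𝓞 E))) (hS : ∀ I ∈ S, (Ideal.absNorm I : ℝ) ≤ y) :
    ∑ I ∈ S with (∃ k : ℕ, 0 < k ∧ I = v.asIdeal ^ k), idealVonMangoldt I ≤ Real.log y := by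
  classical
  set P := v.asIdeal with hP
  have hPprime : Prime P := Ideal.prime_of_isPrime v.ne_bot v.isPrime
  have hNP2 : (2 : ℝ) ≤ (Ideal.absNorm P : ℝ) := by
    have h1 : 1 < Ideal.absNorm P := by
      have h0 : Ideal.absNorm P ≠ 0 := by rw [ne_eq, Ideal.absNorm_eq_zero_iff]; exact v.ne_bot
      have h1 : Ideal.absNorm P ≠ 1 := by rw [ne_eq, Ideal.absNorm_eq_one_iff]; exact v.isPrime.ne_top
      omega
    exact_mod_cast h1
  have hlogP : 0 < Real.log (Ideal.absNorm P : ℝ) := Real.log_pos (by linarith)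
  have hlogy : 0 ≤ Real.log y := Real.log_nonneg hy
  set K : ℕ := ⌊Real.log y / Real.log (Ideal.absNorm P : ℝ)⌋₊ with hK
  -- the filtered set is contained in the image of `k ↦ P^k`, `1 ≤ k ≤ K`
  have hsub : S.filter (fun I ↦ ∃ k : ℕ, 0 < k ∧ I = P ^ k) ⊆ (Finset.Icc 1 K).image (fun k ↦ P ^ k) := by
    intro I hI
    rw [Finset.mem_filter] at hI
    obtain ⟨hIS, k, hk, rfl⟩ := hI
    rw [Finset.mem_image]
    refine ⟨k, Finset.mem_Icc.mpr ⟨hk, ?_⟩, rfl⟩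
    rw [hK, Nat.le_floor_iff (div_nonneg hlogy hlogP.le), le_div_iff₀ hlogP, ← Real.log_pow]
    refine Real.log_le_log (by positivity) ?_
    have := hS _ hIS
    rwa [map_pow, Nat.cast_pow] at this
  calc ∑ I ∈ S with (∃ k : ℕ, 0 < k ∧ I = P ^ k), idealVonMangoldt I
      ≤ ∑ I ∈ (Finset.Icc 1 K).image (fun k ↦ P ^ k), idealVonMangoldt I :=
        Finset.sum_le_sum_of_subset_of_nonneg hsub fun I _ _ ↦ idealVonMangoldt_nonneg I
    _ ≤ ∑ k ∈ Finset.Icc 1 K, idealVonMangoldt (P ^ k) := Finset.sum_image_le_of_nonneg fun k _ ↦ idealVonMangoldt_nonneg _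
    _ = ∑ k ∈ Finset.Icc 1 K, Real.log (Ideal.absNorm P : ℝ) :=
        Finset.sum_congr rfl fun k hk ↦ by
          rw [idealVonMangoldt_prime_pow hPprime (by have := (Finset.mem_Icc.mp hk).1; omega)]
    _ = K * Real.log (Ideal.absNorm P : ℝ) := by rw [Finset.sum_const, Nat.card_Icc, nsmul_eq_mul]; push_cast; ring_nf
    _ ≤ Real.log y / Real.log (Ideal.absNorm P : ℝ) * Real.log (Ideal.absNorm P : ℝ) :=
        mul_le_mul_of_nonneg_right (Nat.floor_le (div_nonneg hlogy hlogP.le)) hlogP.le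
    _ = Real.log y := div_mul_cancel₀ _ hlogP.ne'

/-! ### The bound for `ψ_{w_ram}` -/

/-- **The ramified junk is small**: `ψ_{w_ram}(y) ≤ [E:ℚ] · ω(|d_N|) · log y` for `y ≥ 1`, where `w_ram` is
the indicator of the powers `𝔭^k` (`k ≥ 1`) of the primes `𝔭` of `E` ramified in `N`.
[cite: LagariasMontgomeryOdlyzko1979, §3] -/
theorem psiWeighted_ram_le {wr : Ideal (𝓞 E) → ℝ}
    (hwr : ∀ I, wr I = if (∃ v : HeightOneSpectrum (𝓞 E), ¬ Algebra.IsUnramifiedIn (𝓞 N) v.asIdeal ∧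
      ∃ k : ℕ, 0 < k ∧ I = v.asIdeal ^ k) then 1 else 0)
    {y : ℝ} (hy : 1 ≤ y) :
    (∑ n ∈ Icc 0 ⌊y⌋₊, ∑ I ∈ idealsOfNorm E n, wr I * idealVonMangoldt I) ≤
      Module.finrank ℚ E * ((NumberField.discr N).natAbs.primeFactors.card) * Real.log y := by
  classical
  set Y : ℕ := ⌊y⌋₊ with hY
  -- one finite set of ideals
  set S : Finset (Ideal (𝓞 E)) := (Icc 0 Y).biUnion (fun n ↦ idealsOfNorm E n) with hSdef
  have hdisj : Set.PairwiseDisjoint (↑(Icc 0 Y) : Set ℕ) (fun n ↦ idealsOfNorm E n) := by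
    intro a _ b _ hab
    rw [Function.onFun, Finset.disjoint_left]
    intro I ha hb
    rw [mem_idealsOfNorm] at ha hb
    exact hab (ha.symm.trans hb)
  have hS : ∀ I ∈ S, (Ideal.absNorm I : ℝ) ≤ y := by
    intro I hI
    rw [hSdef, Finset.mem_biUnion] at hI
    obtain ⟨n, hn, hIn⟩ := hI
    rw [mem_idealsOfNorm] at hIn
    rw [hIn]
    have := (Finset.mem_Icc.mp hn).2
    calc (n : ℝ) ≤ Y := by exact_mod_cast this
      _ ≤ y := Nat.floor_le (by linarith)
  have hmemS : ∀ I : Ideal (𝓞 E), (Ideal.absNorm I : ℝ) ≤ y → I ∈ S := by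
    intro I hI
    rw [hSdef, Finset.mem_biUnion]
    refine ⟨Ideal.absNorm I, Finset.mem_Icc.mpr ⟨Nat.zero_le _, ?_⟩, mem_idealsOfNorm.mpr rfl⟩
    rw [hY, Nat.le_floor_iff (by linarith)]; exact hI
  rw [← Finset.sum_biUnion hdisj]
  -- the ramified primes of norm `≤ y`
  set d : ℕ := (NumberField.discr N).natAbs with hd
  set Ram : Finset (Ideal (𝓞 E)) := S.filter (fun P ↦ ∃ v : HeightOneSpectrum (𝓞 E), v.asIdeal = P ∧
    ¬ Algebra.IsUnramifiedIn (𝓞 N) v.asIdeal) with hRamdef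
  have hRamsub : Ram ⊆ d.primeFactors.biUnion (fun p ↦ IsDedekindDomain.primesOverFinset (Ideal.span {(p : ℤ)}) (𝓞 E)) := by
    intro P hP
    rw [hRamdef, Finset.mem_filter] at hP
    obtain ⟨-, v, rfl, hram⟩ := hP
    obtain ⟨p, hp, hpv, hmem⟩ := exists_prime_mem v
    rw [Finset.mem_biUnion]
    refine ⟨p, ?_, hmem⟩
    rw [Nat.mem_primeFactors]
    refine ⟨hp, ?_, Int.natAbs_ne_zero.mpr (NumberField.discr_ne_zero N)⟩
    have h := Int.natAbs_dvd_natAbs.mpr (dvd_discr_of_not_isUnramifiedIn v hp hpv hram)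
    rwa [Int.natAbs_natCast] at h
  have hRamcard : (Ram.card : ℝ) ≤ Module.finrank ℚ E * (d.primeFactors.card : ℝ) := by
    have h1 := Finset.card_le_card hRamsub
    have h2 := Finset.card_biUnion_le (s := d.primeFactors)
      (t := fun p ↦ IsDedekindDomain.primesOverFinset (Ideal.span {(p : ℤ)}) (𝓞 E))
    have h3 : ∑ p ∈ d.primeFactors, (IsDedekindDomain.primesOverFinset (Ideal.span {(p : ℤ)}) (𝓞 E)).card ≤
        ∑ p ∈ d.primeFactors, Module.finrank ℚ E := by
      refine Finset.sum_le_sum fun p hp ↦ ?_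
      have hpp : p.Prime := Nat.prime_of_mem_primeFactors hp
      haveI := Fact.mk hpp
      exact Ideal.card_primesOverFinset_le_finrank (𝓞 E) ℚ E (by simp [hpp.ne_zero])
    rw [Finset.sum_const, smul_eq_mul] at h3
    have : Ram.card ≤ d.primeFactors.card * Module.finrank ℚ E := h1.trans (h2.trans h3)
    have : (Ram.card : ℝ) ≤ (d.primeFactors.card : ℝ) * Module.finrank ℚ E := by exact_mod_cast this
    linarith
  -- pointwise: `w_ram(I) Λ(I) ≤ Σ_{P ∈ Ram} [I = P^k, k ≥ 1] Λ(I)`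
  have hpt : ∀ I ∈ S, wr I * idealVonMangoldt I ≤
      ∑ P ∈ Ram, if (∃ k : ℕ, 0 < k ∧ I = P ^ k) then idealVonMangoldt I else 0 := by
    intro I hI
    have hnn : 0 ≤ ∑ P ∈ Ram, if (∃ k : ℕ, 0 < k ∧ I = P ^ k) then idealVonMangoldt I else 0 :=
      Finset.sum_nonneg fun P _ ↦ by split_ifs <;> [exact idealVonMangoldt_nonneg I; exact le_rfl]
    rw [hwr I]
    split_ifs with h
    · obtain ⟨v, hram, k, hk, hIk⟩ := h
      have hvS : v.asIdeal ∈ S := by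
        refine hmemS _ (le_trans ?_ (hS I hI))
        rw [hIk, map_pow, Nat.cast_pow]
        have h1 : (1 : ℝ) ≤ (Ideal.absNorm v.asIdeal : ℝ) := by
          exact_mod_cast Nat.one_le_iff_ne_zero.mpr (by rw [ne_eq, Ideal.absNorm_eq_zero_iff]; exact v.ne_bot)
        exact le_self_pow₀ h1 hk.ne'
      have hvRam : v.asIdeal ∈ Ram := by
        rw [hRamdef, Finset.mem_filter]; exact ⟨hvS, v, rfl, hram⟩
      rw [one_mul]
      refine le_trans (le_of_eq ?_) (Finset.single_le_sum (f := fun P ↦ if (∃ k : ℕ, 0 < k ∧ I = P ^ k) then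
        idealVonMangoldt I else 0) (fun P _ ↦ by
          split_ifs <;> [exact idealVonMangoldt_nonneg I; exact le_rfl]) hvRam)
      rw [if_pos ⟨k, hk, hIk⟩]
    · rw [zero_mul]; exact hnn
  calc ∑ I ∈ S, wr I * idealVonMangoldt I
      ≤ ∑ I ∈ S, ∑ P ∈ Ram, (if (∃ k : ℕ, 0 < k ∧ I = P ^ k) then idealVonMangoldt I else 0) :=
        Finset.sum_le_sum hpt
    _ = ∑ P ∈ Ram, ∑ I ∈ S, (if (∃ k : ℕ, 0 < k ∧ I = P ^ k) then idealVonMangoldt I else 0) := Finset.sum_comm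
    _ = ∑ P ∈ Ram, ∑ I ∈ S with (∃ k : ℕ, 0 < k ∧ I = P ^ k), idealVonMangoldt I :=
        Finset.sum_congr rfl fun P _ ↦ by rw [Finset.sum_filter]
    _ ≤ ∑ P ∈ Ram, Real.log y := by
        refine Finset.sum_le_sum fun P hP ↦ ?_
        rw [hRamdef, Finset.mem_filter] at hP
        obtain ⟨-, v, rfl, -⟩ := hP
        exact sum_primePow_vonMangoldt_le_log v hy S hS
    _ = Ram.card * Real.log y := by rw [Finset.sum_const, nsmul_eq_mul]
    _ ≤ Module.finrank ℚ E * (d.primeFactors.card : ℝ) * Real.log y :=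
        mul_le_mul_of_nonneg_right hRamcard (Real.log_nonneg hy)

end Summit.QuantumAdvantage.QuantumAdvantage.Theorems.DegreeOnePrimesEscape
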